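import Summits.RiemannHypothesis.RiemannHypothesis.Theorems.PfPersistenceLocalityBarrier

/-!
# PF persistence — the GAP CLASS G1, typed (pub-rhpf, barrier-typer gen 2)

**HONEST FRAMING. This is a long-odds MECHANISM SEARCH; no RH claims.** Labels PROVED / TYPED / DATA as in
`PfPersistenceAdmissibleClass.lean`. This file types the cell's one open gap class `𝒞₁ = G1` ("all-window, window-wise
open or locally constant, non-local at every height, failures escaping along the declared dials"; rulings A15 / A19 /
A22 R7 of the cell's ADJ-LOG) over the re-typed `Window` (`ha : 0 < a`). No statement here bears on RH: membership in
G1 constrains the SHAPE of a criterion, never whether `ζ` satisfies it.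

* §1 HEIGHT-LOCALITY `DeterminedOn S T` (= the barrier-prover's `IsLocal (· ∈ S) T`), `below A`; clause (2)
  `NonlocalAtEveryHeight S := ∀ A, ¬ DeterminedOn S (below A)` (PROVED `⇒ ¬ FinitelyDetermined`; exit criterion).
* §2 DECLARED DIALS through `ζ` at the Galerkin level: `pDial p K = datumOf (dial p K ζ)` (`K → 1`: one-prime reweighting,
  `λ`-pert, two-sided `p`-dials) and `shiftDial δ = shift δ ζ` (`δ → 0`, operator domain); PROVED window-wise convergence.
* §3 clause (3) FAILURE ESCAPE as a CONJUNCT: `StableAlong` (= hypothesis `hstab` of the barrier-prover's W4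
  `failure_windows_escape`; PROVED native W4 `StableAlong.not_eventually_fails_within`), `DialStable S`; the literal
  bounded-height reading `EscapesBelowAlong` / `DialEscape S` (`∀ A ∀ᶠ i`) is NOT automatic — stricter variant `InG1contU`.
* §4 `InG1cont S := IsWindowwiseOpen S ∧ NonlocalAtEveryHeight S ∧ DialStable S`; PROVED `IsWindowwiseOpen.dialStable`
  (clause (3) follows from the open presentation): a MEMBERSHIP CERTIFICATE (clause (4)) is `inG1cont_of ⟨U, hU, rfl⟩ exits`.
* §5 STRICT POSITIVITY `P⁺ = strictPositiveClass` (A19 (a)): window-wise OPEN (PROVED, compactness of the unit sphere),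
  non-local at every height (PROVED) ⇒ `inG1cont_strictPositiveClass` (PROVED certificate); the closed class
  `positiveClass` is NOT window-wise open (PROVED `positiveClass_not_isWindowwiseOpen`).
* §6 G1-int (A19 (b)): `IsWindowwise`, `IsWindowwiseLocallyConstantAt S ζ`, `InG1int`; PROVED
  `IsWindowwiseLocallyConstantAt.dialStable`, `IsWindowwiseOpen.locallyConstantAt`.
* §7 `τ_rel` (A22 R7): gauge-relative closeness `UniformlyCloseRel γ`, `UniformlyRobustRelAt γ`, the bottom-gap gauge;
  PROVED: a gauge bounded below turns relative robustness into absolute robustness (W2 applies), a gauge bounded above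
  the converse — the `τ_rel` DOOR is exactly `inf_win γ(win) = 0` (for `ζ`'s bottom gap: DATA, PF-N2 / Table N2).
-/

set_option linter.dupNamespace false  -- the mandated namespace repeats `RiemannHypothesis`

noncomputable section

open Real Finset Matrix Filter Topology

namespace Summit.RiemannHypothesis.RiemannHypothesis.Theorems.PfPersistence

/-! ## §1 Height-locality (clause (2) of G1) -/

/-- `S` is DETERMINED ON the window set `T`: membership depends on the datum only through its matrices at the windows
of `T` (the barrier-prover's `IsLocal (· ∈ S) T`, `PfPersistenceBarrierWalls.lean`, specialised to `Datum`). [folklore] -/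
def DeterminedOn (S : Set Datum) (T : Set Window) : Prop :=
  ∀ d d' : Datum, (∀ win ∈ T, d win = d' win) → (d ∈ S ↔ d' ∈ S)

/-- the windows of height `≤ A` (a dataset whose windows stop at `a = A`, all truncations `N`). [folklore] -/
def below (A : ℝ) : Set Window := {win | win.a ≤ A}

/-- determined on `T` ⇒ determined on every larger window set. [folklore] -/
theorem DeterminedOn.mono {S : Set Datum} {T T' : Set Window} (h : DeterminedOn S T) (hT : T ⊆ T') :
    DeterminedOn S T' :=
  fun d d' hdd' => h d d' fun win hwin => hdd' win (hT hwin)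

/-- PROVED: finitely determined ⇒ determined below some height (`A = Σ_{win ∈ W} a(win)`, all `a > 0`). [folklore] -/
theorem FinitelyDetermined.exists_determinedOn_below {S : Set Datum} (h : FinitelyDetermined S) :
    ∃ A : ℝ, DeterminedOn S (below A) := by
  obtain ⟨W, hW⟩ := h
  refine ⟨∑ win ∈ W, win.a, fun d d' hdd' => hW d d' fun win hwin => hdd' win ?_⟩
  exact Finset.single_le_sum (f := fun win : Window => win.a) (fun w _ => w.ha.le) hwin

/-- clause (2) of G1: NON-LOCAL AT EVERY HEIGHT (A15: "`¬ IsLocal P S` for every bounded `S`"). [folklore] -/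
def NonlocalAtEveryHeight (S : Set Datum) : Prop := ∀ A : ℝ, ¬ DeterminedOn S (below A)

/-- PROVED: non-local at every height ⇒ not finitely determined (outside the locality barrier's class). [folklore] -/
theorem NonlocalAtEveryHeight.not_finitelyDetermined {S : Set Datum} (h : NonlocalAtEveryHeight S) :
    ¬ FinitelyDetermined S := fun hS => by
  obtain ⟨A, hA⟩ := hS.exists_determinedOn_below
  exact h A hA

/-- PROVED (exit criterion): a datum outside `S` agreeing with a member off one window `win₀ ∉ T` shows `S` is not
determined on `T`. [folklore] -/
theorem not_determinedOn_of_exit {S : Set Datum} {T : Set Window} {d₀ d : Datum} (h₀ : d₀ ∈ S) (hd : d ∉ S)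
    {win₀ : Window} (hwin₀ : win₀ ∉ T) (hagree : ∀ win, win ≠ win₀ → d win = d₀ win) : ¬ DeterminedOn S T :=
  fun hT => hd ((hT d₀ d fun win hwin => (hagree win (ne_of_mem_of_not_mem hwin hwin₀)).symm).1 h₀)

/-- a genuine window strictly above height `A`. [folklore] -/
def windowAbove (A : ℝ) : Window := ⟨max A 0 + 1, 0, by positivity⟩

/-- `windowAbove A` is not below `A`. [folklore] -/
theorem windowAbove_not_mem_below (A : ℝ) : windowAbove A ∉ below A :=
  not_le.2 ((le_max_left A 0).trans_lt (lt_add_one _))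

/-! ## §2 The declared dials through `ζ` (Galerkin level) -/

/-- the `p`-DIAL through `ζ`: reweight the single position `p` by `K` (`K → 1`; `K = 1 ± δ` is `λ`-pert, `K = 0` deletion). [folklore] -/
def pDial (p : ℕ) (K : ℝ) : Datum := datumOf (dial p K zetaWeights)

/-- the `p`-dial inside the window's range: a rank-one move along `primePattern p`. [folklore] -/
theorem pDial_apply_of_mem {p : ℕ} {win : Window} (hp : p ∈ primeRange (2 * win.a)) (K : ℝ) :
    pDial p K win = zetaDatum win - (2 * (K - 1) * zetaWeights p) • primePattern p win :=
  evenBlock_dial_eq hp K zetaWeights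

/-- the `p`-dial beyond the window's range is invisible (locality). [folklore] -/
theorem pDial_apply_of_not_mem {p : ℕ} {win : Window} (hp : p ∉ primeRange (2 * win.a)) (K : ℝ) :
    pDial p K win = zetaDatum win :=
  evenBlock_dial_of_not_mem (not_mem_primeRange_iff.1 hp) K zetaWeights

/-- PROVED: the `p`-dial converges to `ζ` window-wise as `K → 1`. [folklore] -/
theorem tendsto_pDial (p : ℕ) (win : Window) : Tendsto (fun K => pDial p K win) (𝓝 1) (𝓝 (zetaDatum win)) := by
  by_cases hp : p ∈ primeRange (2 * win.a)
  · simp only [pDial_apply_of_mem hp]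
    have hc : Continuous fun K : ℝ => zetaDatum win - (2 * (K - 1) * zetaWeights p) • primePattern p win := by
      fun_prop
    simpa using hc.tendsto 1
  · simp only [pDial_apply_of_not_mem hp]
    exact tendsto_const_nhds

/-- PROVED: the shift family of any datum converges to it window-wise as `δ → 0`. [folklore] -/
theorem tendsto_shift (d : Datum) (win : Window) : Tendsto (fun δ => shift δ d win) (𝓝 0) (𝓝 (d win)) := by
  have hc : Continuous fun δ : ℝ => d win - δ • (1 : Matrix (Fin (win.N + 1)) (Fin (win.N + 1)) ℝ) := by
    fun_prop
  simpa [shift] using hc.tendsto 0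

/-- the SHIFT dial through `ζ` (`δ → 0`; operator domain, not `dialSpace`). [folklore] -/
def shiftDial (δ : ℝ) : Datum := shift δ zetaDatum

/-- PROVED: the shift dial converges to `ζ` window-wise as `δ → 0`. [folklore] -/
theorem tendsto_shiftDial (win : Window) : Tendsto (fun δ => shiftDial δ win) (𝓝 0) (𝓝 (zetaDatum win)) :=
  tendsto_shift zetaDatum win

/-! ## §3 Clause (3): failure escape along the declared dials, as a conjunct -/

/-- PER-WINDOW STABILITY of `S` along the dial `c` at the filter `l`: at each window, eventually along the dial the
dialled matrix is the matrix of SOME member of `S` (for window-wise sets: lies in that window's admissible set). This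
is the hypothesis `hstab` of the barrier-prover's W4 `failure_windows_escape`. [folklore] -/
def StableAlong (S : Set Datum) {ι : Type*} (l : Filter ι) (c : ι → Datum) : Prop :=
  ∀ win, ∀ᶠ i in l, ∃ d ∈ S, c i win = d win

/-- PROVED (W4, native form): along a stable dial the dialled data cannot eventually fail inside a FIXED finite window
set — failures, if any, escape every finite set of windows. [folklore] -/
theorem StableAlong.not_eventually_fails_within {S : Set Datum} {ι : Type*} {l : Filter ι} [l.NeBot]
    {c : ι → Datum} (h : StableAlong S l c) (F : Finset Window) :
    ¬ ∀ᶠ i in l, ∃ win ∈ F, ¬ ∃ d ∈ S, c i win = d win := by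
  intro hfail
  have hall : ∀ᶠ i in l, ∀ win ∈ F, ∃ d ∈ S, c i win = d win :=
    (Filter.eventually_all_finset F).2 fun win _ => h win
  obtain ⟨i, hi, win, hwin, hnot⟩ := (hall.and hfail).exists
  exact hnot (hi win hwin)

/-- ESCAPE BELOW EVERY HEIGHT along a dial — the literal `∀ A ∀ᶠ i` reading of clause (3): for every height `A`,
eventually along the dial the dialled datum agrees BELOW `A` with some member of `S`. NOT automatic for window-wise
open sets (it is equi-openness over all windows of height `≤ A`: every `N`, a continuum of `a`). [folklore] -/
def EscapesBelowAlong (S : Set Datum) {ι : Type*} (l : Filter ι) (c : ι → Datum) : Prop :=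
  ∀ A : ℝ, ∀ᶠ i in l, ∃ d ∈ S, ∀ win ∈ below A, c i win = d win

/-- PROVED: escape below every height ⇒ per-window stability. [folklore] -/
theorem EscapesBelowAlong.stableAlong {S : Set Datum} {ι : Type*} {l : Filter ι} {c : ι → Datum}
    (h : EscapesBelowAlong S l c) : StableAlong S l c := fun win =>
  (h win.a).mono fun _ ⟨d, hdS, hd⟩ => ⟨d, hdS, hd win (le_refl win.a)⟩

/-- clause (3) of G1: DIAL-STABLE at `ζ` along EVERY DECLARED DIAL (`p`-dials `K → 1`, `K ≠ 1`, all primes `p`; shift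
`δ → 0`, `δ ≠ 0`), required when `ζ ∈ S` (a member not claiming `ζ` makes W4 moot). [folklore] -/
def DialStable (S : Set Datum) : Prop :=
  zetaDatum ∈ S →
    (∀ p : ℕ, p.Prime → StableAlong S (𝓝[≠] (1 : ℝ)) (pDial p)) ∧ StableAlong S (𝓝[≠] (0 : ℝ)) shiftDial

/-- the stricter bounded-height variant of clause (3) (`∀ A ∀ᶠ i`), see `EscapesBelowAlong`. [folklore] -/
def DialEscape (S : Set Datum) : Prop :=
  zetaDatum ∈ S →
    (∀ p : ℕ, p.Prime → EscapesBelowAlong S (𝓝[≠] (1 : ℝ)) (pDial p)) ∧ EscapesBelowAlong S (𝓝[≠] (0 : ℝ)) shiftDial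

/-- PROVED: the bounded-height variant implies the finite-window one. [folklore] -/
theorem DialEscape.dialStable {S : Set Datum} (h : DialEscape S) : DialStable S := fun hζ =>
  ⟨fun p hp => ((h hζ).1 p hp).stableAlong, (h hζ).2.stableAlong⟩

/-! ## §4 G1-cont -/

/-- **G1-cont** (`𝒞₁`, continuous stratum; A15 / A19): ALL-WINDOW criteria that are window-wise OPEN (clause (1),
matrix topology per window), NON-LOCAL AT EVERY HEIGHT (clause (2)) and DIAL-STABLE at `ζ` along the declared dials
(clause (3)). None of W1–W4 closes such a member: W1 needs `FinitelyDetermined`, W2 a window-UNIFORM margin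
(`UniformlyRobustAt`, which a member separating `ζ` from accumulating negatives cannot have), W3 is the tautology T0,
W4 only says where failures go. RH-strength is decided member-wise, never by the class. [folklore] -/
def InG1cont (S : Set Datum) : Prop :=
  IsWindowwiseOpen S ∧ NonlocalAtEveryHeight S ∧ DialStable S

/-- the stricter class with the bounded-height escape clause. [folklore] -/
def InG1contU (S : Set Datum) : Prop := InG1cont S ∧ DialEscape S

/-- PROVED: a window-wise open set containing `ζ` is stable along every dial converging to `ζ` window-wise (patch `ζ`
at the one window). [folklore] -/
theorem IsWindowwiseOpen.stableAlong {S : Set Datum} (hS : IsWindowwiseOpen S) (hζ : zetaDatum ∈ S) {ι : Type*}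
    {l : Filter ι} {c : ι → Datum} (hc : ∀ win, Tendsto (fun i => c i win) l (𝓝 (zetaDatum win))) :
    StableAlong S l c := by
  classical
  obtain ⟨U, hU, rfl⟩ := hS
  intro win
  have hζU : ∀ w, zetaDatum w ∈ U w := hζ
  refine ((hc win).eventually_mem ((hU win).mem_nhds (hζU win))).mono fun i hi => ?_
  refine ⟨Function.update zetaDatum win (c i win), fun w => ?_, by simp⟩
  by_cases hw : w = win
  · subst hw; simpa using hi
  · simpa [hw] using hζU w

/-- PROVED: clause (3) is discharged by the open presentation. [folklore] -/
theorem IsWindowwiseOpen.dialStable {S : Set Datum} (hS : IsWindowwiseOpen S) : DialStable S := fun hζ =>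
  ⟨fun p _ => hS.stableAlong hζ fun win => (tendsto_pDial p win).mono_left nhdsWithin_le_nhds,
    hS.stableAlong hζ fun win => (tendsto_shiftDial win).mono_left nhdsWithin_le_nhds⟩

/-- PROVED — the MEMBERSHIP CERTIFICATE schema (clause (4)): open presentation + height exits ⇒ G1-cont. [folklore] -/
theorem inG1cont_of {S : Set Datum} (hS : IsWindowwiseOpen S) (hnl : NonlocalAtEveryHeight S) : InG1cont S :=
  ⟨hS, hnl, hS.dialStable⟩

/-- PROVED: G1-cont members are not finitely determined (clause (2) ⇒ outside `τ_fin`). [folklore] -/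
theorem InG1cont.not_finitelyDetermined {S : Set Datum} (h : InG1cont S) : ¬ FinitelyDetermined S :=
  h.2.1.not_finitelyDetermined

/-! ## §5 The strict positive class `P⁺` (A19 (a)): an issued certificate -/

/-- STRICT window positivity `M ≻ 0` as a form. [folklore] -/
def WindowStrictlyPositive {n : ℕ} (M : Matrix (Fin n) (Fin n) ℝ) : Prop :=
  ∀ v : Fin n → ℝ, v ≠ 0 → 0 < v ⬝ᵥ (M *ᵥ v)

/-- `P⁺`: strictly positive at every window (for `ζ` on the served windows `P⁺ = P`: certified `ε₁ > 0`, DATA). [folklore] -/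
def strictPositiveClass : Set Datum := {d | ∀ win, WindowStrictlyPositive (d win)}

/-- PROVED: `P⁺ ⊆ P`. [folklore] -/
theorem strictPositiveClass_subset_positiveClass : strictPositiveClass ⊆ positiveClass := fun d hd win v =>
  (eq_or_ne v 0).elim (fun hv => by subst hv; simp) fun hv => (hd win v hv).le

/-- PROVED: strict form-positivity is an OPEN condition on matrices (joint continuity of `(M, v) ↦ vᵀMv` and
compactness of the unit sphere). [folklore] -/
theorem isOpen_setOf_windowStrictlyPositive (n : ℕ) :
    IsOpen {M : Matrix (Fin n) (Fin n) ℝ | WindowStrictlyPositive M} := by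
  rw [isOpen_iff_eventually]
  intro M₀ hM₀
  have hq : Continuous fun z : Matrix (Fin n) (Fin n) ℝ × (Fin n → ℝ) => z.2 ⬝ᵥ (z.1 *ᵥ z.2) :=
    continuous_snd.dotProduct (continuous_fst.matrix_mulVec continuous_snd)
  have hK : IsCompact (Metric.sphere (0 : Fin n → ℝ) 1) := isCompact_sphere 0 1
  have h1 : ∀ v ∈ Metric.sphere (0 : Fin n → ℝ) 1,
      ∀ᶠ z : Matrix (Fin n) (Fin n) ℝ × (Fin n → ℝ) in 𝓝 (M₀, v), 0 < z.2 ⬝ᵥ (z.1 *ᵥ z.2) := by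
    intro v hv
    have hv0 : v ≠ 0 := by
      intro h
      simp [h] at hv
    exact (hq.tendsto (M₀, v)).eventually (lt_mem_nhds (hM₀ v hv0))
  have h2 := hK.eventually_forall_of_forall_eventually (P := fun M v => 0 < v ⬝ᵥ (M *ᵥ v)) h1
  refine h2.mono fun M hM v hv0 => ?_
  have hr : 0 < ‖v‖ := norm_pos_iff.2 hv0
  have hu : ‖v‖⁻¹ • v ∈ Metric.sphere (0 : Fin n → ℝ) 1 := by
    rw [mem_sphere_zero_iff_norm, norm_smul, norm_inv, norm_norm, inv_mul_cancel₀ hr.ne']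
  have h3 := hM (‖v‖⁻¹ • v) hu
  simp only [Matrix.mulVec_smul, dotProduct_smul, smul_dotProduct, smul_eq_mul] at h3
  have hi : 0 < ‖v‖⁻¹ := inv_pos.2 hr
  exact (mul_pos_iff_of_pos_left hi).1 ((mul_pos_iff_of_pos_left hi).1 h3)

/-- PROVED: `P⁺` is window-wise open (clause (1)). [folklore] -/
theorem isWindowwiseOpen_strictPositiveClass : IsWindowwiseOpen strictPositiveClass :=
  ⟨fun _ => {M | WindowStrictlyPositive M}, fun _ => isOpen_setOf_windowStrictlyPositive _, rfl⟩

/-- the identity datum. [folklore] -/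
def oneDatum : Datum := fun win => (1 : Matrix (Fin (win.N + 1)) (Fin (win.N + 1)) ℝ)

/-- the identity datum is strictly positive. [folklore] -/
theorem oneDatum_mem_strictPositiveClass : oneDatum ∈ strictPositiveClass := by
  intro win v hv
  rw [oneDatum, Matrix.one_mulVec]
  exact lt_of_le_of_ne (dotProduct_self_nonneg_real v) fun h => hv (dotProduct_self_eq_zero.1 h.symm)

/-- PROVED: `P⁺` is non-local at every height (clause (2); exit: zero out the one window above `A`). [folklore] -/
theorem nonlocalAtEveryHeight_strictPositiveClass : NonlocalAtEveryHeight strictPositiveClass := by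
  classical
  intro A
  refine not_determinedOn_of_exit oneDatum_mem_strictPositiveClass ?_ (windowAbove_not_mem_below A)
    (d := Function.update oneDatum (windowAbove A) 0) fun win hwin => by simp [hwin]
  intro hd
  have hne : (fun _ : Fin ((windowAbove A).N + 1) => (1 : ℝ)) ≠ 0 := fun h => one_ne_zero (congrFun h 0)
  have h := hd (windowAbove A) _ hne
  simp at h

/-- **PROVED — MEMBERSHIP CERTIFICATE: `P⁺ ∈ G1-cont`.** [folklore] -/
theorem inG1cont_strictPositiveClass : InG1cont strictPositiveClass :=
  inG1cont_of isWindowwiseOpen_strictPositiveClass nonlocalAtEveryHeight_strictPositiveClass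

/-- PROVED (A19 (a)): the CLOSED positive class `𝒫 = {∀ win, · ⪰ 0}` is NOT window-wise open (push the zero datum to
`−δ·1` at one window), hence not a member of G1-cont; its G1 reading is `P⁺`. [folklore] -/
theorem positiveClass_not_isWindowwiseOpen : ¬ IsWindowwiseOpen positiveClass := by
  classical
  rintro ⟨U, hU, hS⟩
  have h0 : (0 : Datum) ∈ positiveClass := fun win v => by simp [Matrix.zero_mulVec]
  have h0U : ∀ w, (0 : Datum) w ∈ U w := by rwa [hS] at h0
  obtain ⟨win₀⟩ : Nonempty Window := ⟨windowAbove 0⟩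
  have hev : ∀ᶠ δ : ℝ in 𝓝[>] 0, shift δ 0 win₀ ∈ U win₀ ∧ δ ∈ Set.Ioi (0 : ℝ) :=
    (((tendsto_shift 0 win₀).mono_left nhdsWithin_le_nhds).eventually_mem ((hU win₀).mem_nhds (h0U win₀))).and
      eventually_mem_nhdsWithin
  obtain ⟨δ, hδU, hδ⟩ := hev.exists
  have hδ' : 0 < δ := hδ
  let d : Datum := Function.update 0 win₀ (shift δ 0 win₀)
  have hd : d ∈ positiveClass := by
    rw [hS]
    intro w
    by_cases hw : w = win₀
    · subst hw; simpa [d] using hδU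
    · simpa [d, hw] using h0U w
  have h1 := hd win₀ (fun _ => 1)
  have hdw : d win₀ = shift δ 0 win₀ := by simp [d]
  have h3 : (fun _ : Fin (win₀.N + 1) => (1 : ℝ)) ⬝ᵥ ((0 : Datum) win₀ *ᵥ fun _ => 1) = 0 := by
    simp [Matrix.zero_mulVec]
  rw [hdw, rayleigh_shift, h3] at h1
  have h2 : (0 : ℝ) < (fun _ : Fin (win₀.N + 1) => (1 : ℝ)) ⬝ᵥ (fun _ => 1) := by
    simp [dotProduct]; positivity
  nlinarith

/-! ## §6 G1-int (A19 (b)): window-wise, locally constant at `ζ` -/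

/-- WINDOW-WISE (product) criteria `S = {d | ∀ w, d_w ∈ V_w}`, any value type (node counts, sign patterns, …). [folklore] -/
def IsWindowwise (S : Set Datum) : Prop :=
  ∃ V : (win : Window) → Set (Matrix (Fin (win.N + 1)) (Fin (win.N + 1)) ℝ), S = {d | ∀ win, d win ∈ V win}

/-- WINDOW-WISE LOCALLY CONSTANT AT `d₀`: at each window, `d₀`'s matrix has an OPEN neighbourhood on which membership
does not depend on that window's matrix (integer-valued per-window functionals — S3-I1/I2 node counts — at a record with
a SIMPLE bottom pair, STRUCTURE-D3 §A: DATA on the served windows). [folklore] -/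
def IsWindowwiseLocallyConstantAt (S : Set Datum) (d₀ : Datum) : Prop :=
  ∀ win, ∃ O : Set (Matrix (Fin (win.N + 1)) (Fin (win.N + 1)) ℝ), IsOpen O ∧ d₀ win ∈ O ∧
    ∀ d d' : Datum, (∀ w, w ≠ win → d w = d' w) → d win ∈ O → d' win ∈ O → (d ∈ S ↔ d' ∈ S)

/-- **G1-int** (`𝒞₁`, step stratum; A15 (2) / A19 (b)): window-wise criteria, locally constant at `ζ` window-wise,
non-local at every height, dial-stable. [folklore] -/
def InG1int (S : Set Datum) : Prop :=
  IsWindowwise S ∧ IsWindowwiseLocallyConstantAt S zetaDatum ∧ NonlocalAtEveryHeight S ∧ DialStable S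

/-- PROVED: local constancy at `ζ` gives stability along every dial converging to `ζ` window-wise. [folklore] -/
theorem IsWindowwiseLocallyConstantAt.stableAlong {S : Set Datum} (hS : IsWindowwiseLocallyConstantAt S zetaDatum)
    (hζ : zetaDatum ∈ S) {ι : Type*} {l : Filter ι} {c : ι → Datum}
    (hc : ∀ win, Tendsto (fun i => c i win) l (𝓝 (zetaDatum win))) : StableAlong S l c := by
  classical
  intro win
  obtain ⟨O, hO, hζO, hconst⟩ := hS win
  refine ((hc win).eventually_mem (hO.mem_nhds hζO)).mono fun i hi =>
    ⟨Function.update zetaDatum win (c i win), ?_, by simp⟩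
  exact (hconst zetaDatum _ (fun w hw => by simp [hw]) hζO (by simpa using hi)).1 hζ

/-- PROVED: clause (3) for G1-int members is discharged by local constancy at `ζ`. [folklore] -/
theorem IsWindowwiseLocallyConstantAt.dialStable {S : Set Datum} (hS : IsWindowwiseLocallyConstantAt S zetaDatum) :
    DialStable S := fun hζ =>
  ⟨fun p _ => hS.stableAlong hζ fun win => (tendsto_pDial p win).mono_left nhdsWithin_le_nhds,
    hS.stableAlong hζ fun win => (tendsto_shiftDial win).mono_left nhdsWithin_le_nhds⟩

/-- PROVED: a window-wise open set containing `ζ` is locally constant at `ζ` (so G1-cont members claiming `ζ` satisfy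
the G1-int clause too; the strata differ in value type, A12). [folklore] -/
theorem IsWindowwiseOpen.locallyConstantAt {S : Set Datum} (hS : IsWindowwiseOpen S) (hζ : zetaDatum ∈ S) :
    IsWindowwiseLocallyConstantAt S zetaDatum := by
  obtain ⟨U, hU, rfl⟩ := hS
  intro win
  refine ⟨U win, hU win, hζ win, fun d d' hdd' hd hd' => ?_⟩
  simp only [Set.mem_setOf_eq]
  constructor
  · intro h w
    by_cases hw : w = win
    · subst hw; exact hd'
    · rw [← hdd' w hw]; exact h w
  · intro h w
    by_cases hw : w = win
    · subst hw; exact hd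
    · rw [hdd' w hw]; exact h w

/-! ## §7 `τ_rel`: gauge-relative uniform closeness (A22 R7) -/

/-- GAUGE-RELATIVE uniform closeness: form-closeness `ε · γ(win)` at each window, for a declared per-window scale `γ`
(the UNITS of a stratum-`u` class, A22 R7: absolute `γ = 1` is `UniformlyClose`; cluster-relative `γ = ` bottom gap of
`ζ`'s window matrix is where PF-I1 lives). [folklore] -/
def UniformlyCloseRel (γ : Window → ℝ) (ε : ℝ) (d d' : Datum) : Prop :=
  ∀ win, ∀ v : Fin (win.N + 1) → ℝ, |v ⬝ᵥ ((d win - d' win) *ᵥ v)| ≤ ε * γ win * (v ⬝ᵥ v)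

/-- `τ_rel(γ)`-ROBUST AT `d₀`. [folklore] -/
def UniformlyRobustRelAt (γ : Window → ℝ) (S : Set Datum) (d₀ : Datum) : Prop :=
  ∃ ε : ℝ, 0 < ε ∧ ∀ d : Datum, UniformlyCloseRel γ ε d₀ d → d ∈ S

/-- `ε₂` by Courant–Fischer (max over `u` of the bottom Rayleigh quotient on `u^⊥`); TYPED object. [folklore] -/
def secondRayleigh {n : ℕ} (M : Matrix (Fin n) (Fin n) ℝ) : ℝ :=
  ⨆ u : Fin n → ℝ, sInf {r : ℝ | ∃ v : Fin n → ℝ, v ≠ 0 ∧ v ⬝ᵥ u = 0 ∧ r = v ⬝ᵥ (M *ᵥ v) / (v ⬝ᵥ v)}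

/-- the BOTTOM-GAP GAUGE `γ(win) = ε₂ − ε₁` of `d₀`'s window matrix (schema `eps2_even − eps1_even`). [folklore] -/
def bottomGapGauge (d₀ : Datum) : Window → ℝ := fun win => secondRayleigh (d₀ win) - bottomRayleigh (d₀ win)

/-- absolute closeness at scale `ε·g` ⇒ relative closeness at scale `ε` for any gauge `≥ g`. [folklore] -/
theorem UniformlyClose.rel {γ : Window → ℝ} {g ε : ℝ} (hg : ∀ win, g ≤ γ win) (hε : 0 ≤ ε) {d d' : Datum}
    (h : UniformlyClose (ε * g) d d') : UniformlyCloseRel γ ε d d' := fun win v =>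
  (h win v).trans (mul_le_mul_of_nonneg_right (mul_le_mul_of_nonneg_left (hg win) hε) (dotProduct_self_nonneg_real v))

/-- **PROVED: with a gauge bounded BELOW by `g > 0`, `τ_rel`-robustness is `τ_unif`-robustness** — the uniform-modulus
barrier W2 then applies verbatim; the `τ_rel` DOOR out of W2 is exactly `inf_win γ(win) = 0` (for `ζ`'s bottom gap the
whole bottom cluster tends to `0` as `a → ∞`: DATA, PF-N2). [folklore] -/
theorem UniformlyRobustRelAt.uniformlyRobustAt {γ : Window → ℝ} {S : Set Datum} {d₀ : Datum}
    (h : UniformlyRobustRelAt γ S d₀) {g : ℝ} (hg0 : 0 < g) (hg : ∀ win, g ≤ γ win) : UniformlyRobustAt S d₀ := by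
  obtain ⟨ε, hε, hS⟩ := h
  exact ⟨ε * g, mul_pos hε hg0, fun d hd => hS d (hd.rel hg hε.le)⟩

/-- PROVED: with a gauge bounded ABOVE, `τ_unif`-robustness gives `τ_rel`-robustness. [folklore] -/
theorem UniformlyRobustAt.uniformlyRobustRelAt {γ : Window → ℝ} {S : Set Datum} {d₀ : Datum}
    (h : UniformlyRobustAt S d₀) {G : ℝ} (hG0 : 0 < G) (hG : ∀ win, γ win ≤ G) : UniformlyRobustRelAt γ S d₀ := by
  obtain ⟨ε, hε, hS⟩ := h
  refine ⟨ε / G, div_pos hε hG0, fun d hd => hS d fun win v => (hd win v).trans ?_⟩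
  have h1 : ε / G * γ win ≤ ε / G * G := mul_le_mul_of_nonneg_left (hG win) (div_pos hε hG0).le
  rw [div_mul_cancel₀ ε hG0.ne'] at h1
  exact mul_le_mul_of_nonneg_right h1 (dotProduct_self_nonneg_real v)

end Summit.RiemannHypothesis.RiemannHypothesis.Theorems.PfPersistence

end
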